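import Summits.QuantumFields.YangMills.Theorems.FlatTubeReductionEigenMomentsBootstrap
import Summits.QuantumFields.YangMills.Theorems.LuscherReductionDressedRitzPolyakovLiftPScalingLevels
import HarnessLib

/-!
# (OC) in crux ONE's currency: the eigen-scale outer coercivity `(1 − E'λ_b)·λ₀` from an absolute rate `linkC³·e^{−Eλ_b + Cλ_b²}` with `E` arbitrary
# (route `FlatTubeReduction`, crux K1 `NearFlatRatioLaw` stmt-QuantumFields-24720, skeleton «ratepack-v2» stub `stub_outerCoercive`; seat `ym-line-ftr-p1` g10;
# R2b1 RECORD rung — no summit statement is proved here)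

The registered stub `stub_outerCoercive` (one-site OUTER COERCIVITY AT THE EIGEN-SCALE, which gives (EM) by `oneSiteEigenMoments_of_outerCoercive`, p665071) is stated relative to the top
level `λ₀(B) = levelValue su2Rep 1 B 0`.  Crux ONE's valley / large-field theorems conclude in the ABSOLUTE currency `linkC B³ · e^{−Eλ_b(B) + Cλ_b(B)²}` (e.g. `PScal.oneSiteAbsUpper_holds`,
`absUpperOuter_of_valley`).  THIS FILE converts: if for EVERY `E` the physical functions vanishing on the eight toron windows of radius `R(E)·λ_b` obey the absolute rate
`linkC³e^{−Eλ_b + Cλ_b²}`, then (OC) holds (`outerCoercive_of_absRate`) — via crux ONE's lower bound `linkC³e^{−E₀λ_b − C₀λ_b²} ≤ λ₀` (`PScal.oneSiteAbsLower_holds 0`, `E₀ = physLevel 1`)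
and `e^{−(E''+1)λ + C̃λ²} ≤ 1 − E''λ` for small `λ`.
HONEST FRAMING: currency glue; the absolute-rate valley bound at the eigen-scale is OPEN; femto rung R2b1 (RECORD label); not infinite volume, not a gap, not Clay.  No defs, no named facts,
no `sorry`.
-/

set_option autoImplicit false

noncomputable section

open MeasureTheory Filter Topology Real
open scoped BigOperators
open Literature.MathematicalPhysics.QuantumFieldTheory
open Literature.MathematicalPhysics.QuantumLattice
open Literature.Analysis.OperatorTheory.YMMatrixModel

namespace Summit.QuantumFields.YangMills.Theorems.FemtoTransferGap.RateTube

open Summit.QuantumFields.YangMills.Theorems.FemtoTransferGap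

/-- Scalar bookkeeping: for `K = E + 1 + |C|` (`E ≥ 1`) and `0 < λ ≤ 1/(|C| + K² + 1)`: `e^{−(E+1)λ + Cλ²} ≤ 1 − Eλ` (from `|eʸ − 1 − y| ≤ y²` for `|y| ≤ 1`). [folklore] -/
theorem exp_rate_le_one_sub {E C lam : ℝ} (hE : 1 ≤ E) (hlam0 : 0 < lam) (hlam : lam ≤ 1 / (|C| + (E + 1 + |C|) ^ 2 + 1)) :
    Real.exp (-((E + 1) * lam) + C * lam ^ 2) ≤ 1 - E * lam := by
  set K : ℝ := E + 1 + |C| with hK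
  have hK2 : 2 ≤ K := by rw [hK]; linarith [abs_nonneg C]
  have hden : 0 < |C| + K ^ 2 + 1 := by positivity
  have hlam1 : lam ≤ 1 := hlam.trans (by rw [div_le_one hden]; nlinarith [abs_nonneg C])
  have hlamK : (|C| + K ^ 2 + 1) * lam ≤ 1 := by rwa [le_div_iff₀ hden, mul_comm] at hlam
  set y : ℝ := -((E + 1) * lam) + C * lam ^ 2 with hy
  -- `|y| ≤ K λ ≤ 1`
  have hyabs : |y| ≤ K * lam := by
    rw [hy, hK]
    refine (abs_add_le _ _).trans ?_
    rw [abs_neg, abs_of_nonneg (by positivity : 0 ≤ (E + 1) * lam), abs_mul, abs_of_nonneg (sq_nonneg lam)]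
    have : |C| * lam ^ 2 ≤ |C| * lam := by
      refine mul_le_mul_of_nonneg_left ?_ (abs_nonneg C); nlinarith
    nlinarith
  have hKlam : K * lam ≤ 1 := by nlinarith [abs_nonneg C]
  have hy1 : |y| ≤ 1 := hyabs.trans hKlam
  have hexp : Real.exp y ≤ 1 + y + y ^ 2 := by
    have h := Real.abs_exp_sub_one_sub_id_le hy1
    rw [abs_le] at h; linarith
  have hy2 : y ^ 2 ≤ K ^ 2 * lam ^ 2 := by
    rw [← sq_abs y, ← mul_pow]
    exact pow_le_pow_left₀ (abs_nonneg y) hyabs 2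
  -- `y + y² + Eλ = −λ + Cλ² + y² ≤ −λ + |C|λ² + K²λ² ≤ 0`
  have hC : C * lam ^ 2 ≤ |C| * lam ^ 2 := mul_le_mul_of_nonneg_right (le_abs_self C) (sq_nonneg lam)
  have hfin : (|C| + K ^ 2) * lam ^ 2 ≤ lam := by nlinarith
  calc Real.exp y ≤ 1 + y + y ^ 2 := hexp
    _ ≤ 1 - E * lam := by rw [hy] at *; nlinarith [hy2, hC, hfin]

/-- ★★ **(OC) from an absolute rate with `E` arbitrary.**  If for every `E` there are `R > 0`, `B₁`, `C` such that every physical `ψ` vanishing on `⋃_z {orbitDist(τ_z ·) < Rλ_b(B)}` has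
`⟨ψ,K_Bψ⟩ ≤ linkC B³·e^{−Eλ_b(B) + Cλ_b(B)²}‖ψ‖²` for `B ≥ B₁`, then the registered stub `stub_outerCoercive` of «ratepack-v2» holds (relative currency `(1 − E'λ_b)·λ₀`).
[cite: Luscher1983, §2] [cite: SimonB1983DiscreteSpectrum, §3] -/
theorem outerCoercive_of_absRate
    (h : ∀ E : ℝ, ∃ R B₁ C : ℝ, 0 < R ∧ ∀ B : ℝ, B₁ ≤ B → ∀ ψ : GaugeConfig 3 1 SU2 → ℝ, IsPhys ψ →
      (∀ U, ψ U ≠ 0 → ∀ z : Fin 3 → Bool, R * bareLambda B ≤ orbitDist (TT.twist3 z U)) →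
        qform su2Rep B ψ ψ ≤ linkC B ^ 3 * Real.exp (-(E * bareLambda B) + C * bareLambda B ^ 2) * l2 ψ ψ) :
    ∀ E' : ℝ, ∃ R B₁ : ℝ, 0 < R ∧ ∀ B : ℝ, B₁ ≤ B → ∀ ψ : GaugeConfig 3 1 SU2 → ℝ, IsPhys ψ →
      (∀ U, ψ U ≠ 0 → ∀ z : Fin 3 → Bool, R * bareLambda B ≤ orbitDist (TT.twist3 z U)) →
        qform su2Rep B ψ ψ ≤ (1 - E' * bareLambda B) * levelValue su2Rep 1 B 0 * l2 ψ ψ := by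
  intro E'
  set E'' : ℝ := |E'| + 1 with hE''
  have hE''1 : 1 ≤ E'' := by rw [hE'']; linarith [abs_nonneg E']
  obtain ⟨C0, B0, h0⟩ := PScal.oneSiteAbsLower_holds 0
  obtain ⟨R, B₁, C, hR, hrate⟩ := h (physLevel 1 + (E'' + 1))
  set Ct : ℝ := C + C0 with hCt
  set τ : ℝ := 1 / (|Ct| + (E'' + 1 + |Ct|) ^ 2 + 1) with hτ
  have hτ0 : 0 < τ := by rw [hτ]; positivity
  refine ⟨R, max (max B0 B₁) (max 1 (2 / τ ^ 3)), hR, fun B hB ψ hψ hsupp => ?_⟩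
  have hB0 : B0 ≤ B := ((le_max_left _ _).trans (le_max_left _ _)).trans hB
  have hB₁ : B₁ ≤ B := ((le_max_right _ _).trans (le_max_left _ _)).trans hB
  have hB1 : 1 ≤ B := ((le_max_left _ _).trans (le_max_right _ _)).trans hB
  have hBτ : 2 / τ ^ 3 ≤ B := ((le_max_right _ _).trans (le_max_right _ _)).trans hB
  have hBpos : 0 < B := by linarith
  set lam := bareLambda B with hlam
  have hlam0 : 0 < lam := bareLambda_pos' hBpos
  have hlamτ : lam ≤ τ := by
    have h1 := bareLambda_cube_le (L := 1) hτ0 hBτ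
    have e1B : ((1 : ℕ) : ℝ) ^ 3 * B = B := by simp
    rw [e1B] at h1; exact h1
  have hN0 : 0 ≤ l2 ψ ψ := l2_self_nonneg_lat ψ
  have hΛlow := h0 B hB0
  have hq := hrate B hB₁ ψ hψ hsupp
  -- the scalar step
  have hstep : Real.exp (-((E'' + 1) * lam) + Ct * lam ^ 2) ≤ 1 - E'' * lam := exp_rate_le_one_sub hE''1 hlam0 hlamτ
  have hsplit : Real.exp (-((physLevel 1 + (E'' + 1)) * lam) + C * lam ^ 2)
      = Real.exp (-(physLevel (0 + 1) * lam) - C0 * lam ^ 2) * Real.exp (-((E'' + 1) * lam) + Ct * lam ^ 2) := by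
    rw [← Real.exp_add, zero_add, hCt]; congr 1; ring
  have hlink : 0 ≤ linkC B ^ 3 := pow_nonneg (linkC_pos hBpos.le).le 3
  have h1 : linkC B ^ 3 * Real.exp (-((physLevel 1 + (E'' + 1)) * lam) + C * lam ^ 2) ≤ (1 - E'' * lam) * levelValue su2Rep 1 B 0 := by
    rw [hsplit, ← mul_assoc]
    have hpos : 0 ≤ linkC B ^ 3 * Real.exp (-(physLevel (0 + 1) * lam) - C0 * lam ^ 2) := mul_nonneg hlink (Real.exp_pos _).le
    calc linkC B ^ 3 * Real.exp (-(physLevel (0 + 1) * lam) - C0 * lam ^ 2) * Real.exp (-((E'' + 1) * lam) + Ct * lam ^ 2)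
        ≤ linkC B ^ 3 * Real.exp (-(physLevel (0 + 1) * lam) - C0 * lam ^ 2) * (1 - E'' * lam) := mul_le_mul_of_nonneg_left hstep hpos
      _ = (1 - E'' * lam) * (linkC B ^ 3 * Real.exp (-(physLevel (0 + 1) * lam) - C0 * lam ^ 2)) := by ring
      _ ≤ (1 - E'' * lam) * levelValue su2Rep 1 B 0 := by
          refine mul_le_mul_of_nonneg_left hΛlow ?_
          -- `E''λ ≤ E''τ ≤ 1`
          have hden : 0 < |Ct| + (E'' + 1 + |Ct|) ^ 2 + 1 := by positivity
          have hτle : τ * E'' ≤ 1 := by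
            rw [hτ, div_mul_eq_mul_div, one_mul, div_le_one hden]; nlinarith [abs_nonneg Ct]
          nlinarith [mul_le_mul_of_nonneg_right hlamτ (by linarith : (0 : ℝ) ≤ E'')]
  have hΛ0 : 0 ≤ levelValue su2Rep 1 B 0 := (levelValue_su2Rep_pos (L := 1) hBpos 0).le
  have h2 : (1 - E'' * lam) * levelValue su2Rep 1 B 0 ≤ (1 - E' * lam) * levelValue su2Rep 1 B 0 := by
    refine mul_le_mul_of_nonneg_right ?_ hΛ0
    have : E' ≤ E'' := by rw [hE'']; linarith [le_abs_self E']
    nlinarith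
  calc qform su2Rep B ψ ψ ≤ linkC B ^ 3 * Real.exp (-((physLevel 1 + (E'' + 1)) * lam) + C * lam ^ 2) * l2 ψ ψ := hq
    _ ≤ (1 - E' * lam) * levelValue su2Rep 1 B 0 * l2 ψ ψ := mul_le_mul_of_nonneg_right (h1.trans h2) hN0

end Summit.QuantumFields.YangMills.Theorems.FemtoTransferGap.RateTube

end
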